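import Summits.BirchSwinnertonDyer.BirchSwinnertonDyer.Theorems.ManinLocalTwoThreeManinOddAtFourEtaTwoLattice
import Summits.BirchSwinnertonDyer.BirchSwinnertonDyer.Theorems.ManinLocalTwoThreeManinOddAtFourEtaTwoMinimalTwist
import Summits.BirchSwinnertonDyer.Rank1Residual.ManinAdditive.TwoNotDvdManinOfTwistAtTwoEdges
import Literature.NumberTheory.EllipticCurves.PAdicLFunctionDistributionProofs
import HarnessLib

/-!
# Crux `ManinOddAtFour` (route `ManinLocalTwoThree`, cell `bsd-f2-manin`), line `dyadic-twist`:
# STUB `stub_etaTwo` = the leaf E-an-1 `TwoNotDvdManinOfTwistEtaTwo` PROVED — Stevens' case `η = 2`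
# of the twist road at `2` («`2 ∤ c₀(𝒜)` for `𝒜 = 𝒜′ ⊗ ℚ(√±2)`, `𝒜′` GOOD SUPERSINGULAR at `2`»)

FILE 3/3 of prover seat `bsd-line-manin23-p3` for the crux item stmt-BirchSwinnertonDyer-22967. The
leaf `Summit.BirchSwinnertonDyer.Rank1Residual.ManinAdditive.TwoNotDvdManinOfTwistEtaTwo` (cell card
E-an-1, planner `bsd-f2-manin-an`, MEMO-an §2–§4; «beyond print»: Stevens 1989 treats `η = 2` only on
`Γ₁` and conditionally) is proved by the planner's route K1 + S1 + K2 + G1, all four now theorems: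

* S1 (Hecke `T₂` on modular symbols) = the tree's `cuspCoeff_mul_modularSymbol` at `p = 2` for the
  newform `f′` of `𝒜′` (odd level): `a₂{∞, r} = {∞, r/2} + {∞, (r+1)/2} + {∞, 2r}`;
* K1 (FILE 1, `half_gaussSum_mul_mem_periodLattice_of_heckeTwo`): `(g(χ)/2)·Λ(f′ ⊗ χ) ⊆ Λ(f′)` for
  `χ = χ_{±8}` since `a₂(f′)` is even (Stevens (5.6)–(5.7) on `Γ₀`);
* K2 (FILE 2, `isGloballyMinimal_quadraticTwist_two_of_even_LFunction_two`): the equation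
  `W₁′.quadraticTwist d` (`d = ±2`, `W₁′` the optimal curve of `𝒜′`) is globally minimal, so by Pal's
  Lemma 3.1 (`isNeronLatticeOf_quadraticTwist_of_sq_eq`) its Néron lattice is `s⁻¹Λ(W₁′)`, `s = g(χ)/2`
  (`s² = d` as `g(χ)² = 4d`): Stevens' Lemma (5.2) with `η = 2`;
* G1 = the tree engine `ManinAdditive.maninConstant_dvd_mul_of_twistStep` (general scalar `s`,
  `r = 1`): `c(D₀) ∣ c(D′)`, and `2 ∤ c(D′)` by Česnavičius 2018 Thm 1.2 at the `2`-good level of `𝒜′`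
  (`cesnavicius2018_not_dvd_maninConstant_of_not_sq_dvd_level`, by-name facts `hM hAU hC2`).
The remaining bookkeeping (levels = conductors under `hnf`, the optimal datum `D′`,
`a_n(f_{D₀}) = χ(n) a_n(f′)`) is VERBATIM the tree's `η = 1` proof
`not_dvd_maninConstant_of_isTwistOfSemistableAtTwo_etaOne_gamma0_of_char`. Union with that theorem:
`TwoNotDvdManinOfTwistOfSemistableAtTwo` (E-an-2) via the landed edge
`twoNotDvdManinOfTwistOfSemistableAtTwo_of_etaTwo`. Manin's conjecture and BSD are NOT proved here:
this is the `e₂ ≤ 2` (twist-covered) half of the crux at `2` modulo the printed semistable facts; the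
twist-minimal core `stub_twistMinimalAtTwo` is untouched.

References: [cite: Stevens1989, Lemmas (5.2), (5.4) and (5.6)–(5.7), pp. 96–98]
[cite: Pal2012, Prop. 2.4 (Connell) and Lemma 3.1] [cite: Cesnavicius2018, Thm. 1.2]
[cite: MazurTateTeitelbaum1986Invent, §I.4 (4.2)] [cite: Mazur1978, Cor. 4.1] [cite: AbbesUllmo1996, Thm. A]
-/

set_option autoImplicit false
set_option linter.dupNamespace false

noncomputable section

open scoped MatrixGroups ModularForm Classical

open CongruenceSubgroup WeierstrassCurve IsDedekindDomain IsDedekindDomain.HeightOneSpectrum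
  NumberField Rat.HeightOneSpectrum Literature.NumberTheory.Automorphic
  Literature.NumberTheory.EllipticCurves Literature.NumberTheory.EllipticCurves.ModularForms
  Summit.BirchSwinnertonDyer.Rank1Residual.ManinAdditive

namespace Summit.BirchSwinnertonDyer.BirchSwinnertonDyer.Theorems

/-! ## 1. Conductor bookkeeping at `2` -/

section Conductor

variable (V : WeierstrassCurve ℚ) [V.IsElliptic]

/-- Good reduction at `2` ⟹ `2 ∤ N(V)` (`f₂ = 0`, `conductorExponent_eq_zero_iff`).
[cite: DiamondShurman2005, §8.3 (p ∣ N_E iff bad reduction)] -/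
theorem not_two_dvd_conductorNorm_of_hasGoodReductionAtPrime_two
    (hgood : V.HasGoodReductionAtPrime 2) : ¬ 2 ∣ V.conductorNorm ℤ := by
  set v2 : HeightOneSpectrum ℤ := (primesEquiv (R := ℤ)).symm ⟨2, Nat.prime_two⟩ with hv2
  have hg' : V.HasGoodReductionAt v2 :=
    (V.hasGoodReductionAtPrime_iff_hasGoodReductionAt_holds ⟨2, Nat.prime_two⟩).mp hgood
  have hf0 : V.conductorExponent v2 = 0 := (conductorExponent_eq_zero_iff_holds v2 V).mpr hg'
  have hfac : (V.conductorNorm ℤ).factorization 2 = 0 := by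
    rw [show (2 : ℕ) = ((⟨2, Nat.prime_two⟩ : Nat.Primes) : ℕ) from rfl,
      factorization_conductorNorm_primesEquiv_symm V ⟨2, Nat.prime_two⟩, ← hv2, hf0]
  intro h2
  have := (Nat.prime_two.dvd_iff_one_le_factorization (conductorNorm_pos_holds V).ne').mp h2
  omega

/-- `2 ∤ N(V)` ⟹ good reduction at `2`. [cite: DiamondShurman2005, §8.3 (p ∣ N_E iff bad reduction)] -/
theorem hasGoodReductionAtPrime_two_of_not_two_dvd_conductorNorm (h2 : ¬ 2 ∣ V.conductorNorm ℤ) :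
    V.HasGoodReductionAtPrime 2 := by
  set v2 : HeightOneSpectrum ℤ := (primesEquiv (R := ℤ)).symm ⟨2, Nat.prime_two⟩ with hv2
  have hfac : (V.conductorNorm ℤ).factorization 2 = 0 := Nat.factorization_eq_zero_of_not_dvd h2
  have hf0 : V.conductorExponent v2 = 0 := by
    rw [hv2, ← factorization_conductorNorm_primesEquiv_symm V ⟨2, Nat.prime_two⟩]
    exact hfac
  exact (V.hasGoodReductionAtPrime_iff_hasGoodReductionAt_holds ⟨2, Nat.prime_two⟩).mpr
    ((conductorExponent_eq_zero_iff_holds v2 V).mp hf0)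

end Conductor

/-! ## 2. The `η = 2` certificate for a given character `χ ∈ {χ₈, χ₈′}` -/

section Core

variable {W : WeierstrassCurve ℚ} [W.IsElliptic]
  {W' : WeierstrassCurve ℚ} [W'.IsElliptic] [W'.IsGloballyMinimal]

/-- **The core of E-an-1** for a given primitive quadratic `χ` mod `8` with `g(χ)² = 4d` and
character-sum shape `F1 + εF3 − F5 − εF7`: `W ∼ W′ ⊗ χ_d` (`d = ±2`), `W′` globally minimal GOOD at
`2` with `a₂(W′)` even, `N(W′) ∣ N(W)`, `8² ∣ N(W)`, `W` additive at `2` ⟹ every lattice-optimal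
datum `D₀` of every globally minimal `W₀ ∼ W` has `2 ∤ c(D₀)`. Structure verbatim the tree's
`not_dvd_maninConstant_of_isTwistOfSemistableAtTwo_etaOne_gamma0_of_char`; the two `η = 2` inputs
are K1 (`half_gaussSum_mul_mem_periodLattice_of_heckeTwo`, fed by `cuspCoeff_mul_modularSymbol`) and
K2 (`isGloballyMinimal_quadraticTwist_two_of_even_LFunction_two`).
[cite: Stevens1989, Lemmas (5.2), (5.4), (5.6)–(5.7)] [cite: Cesnavicius2018, Thm. 1.2]
[cite: Pal2012, Lemma 3.1] -/
theorem not_two_dvd_maninConstant_of_twist_etaTwo_of_char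
    (hM : mazur_not_dvd_maninConstant_of_odd)
    (hAU : abbesUllmo_not_dvd_maninConstant_of_not_dvd_level)
    (hC2 : cesnavicius_not_two_dvd_maninConstant_of_two_dvd_level) (hnf : exists_isNewformOf)
    {d : ℤ} (hd : d = 2 ∨ d = -2)
    {χ : DirichletCharacter ℂ 8} (hχq : χ.IsQuadratic) (hχp : χ.IsPrimitive)
    (hG : gaussSum χ (ZMod.stdAddChar (N := 8)) ^ 2 = ((4 * d : ℤ) : ℂ))
    {ε : ℤ} (hε : ε = 1 ∨ ε = -1)
    (hχsum : ∀ F : ZMod 8 → ℂ, ∑ u : ZMod 8, χ u * F u = F 1 + ε * F 3 - F 5 - ε * F 7)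
    (hχodd : ∀ n : ℕ, ¬ 2 ∣ n →
      (((W'.quadraticTwist (d : ℚ)).LFunction n : ℤ) : ℂ) = χ n * ((W'.LFunction n : ℤ) : ℂ))
    (hχeven : ∀ n : ℕ, 2 ∣ n → χ n = 0)
    (htw : IsIsogenous W (W'.quadraticTwist (d : ℚ)))
    (hN'N : W'.conductorNorm ℤ ∣ W.conductorNorm ℤ) (hmN : 8 ^ 2 ∣ W.conductorNorm ℤ)
    (hgood : W'.HasGoodReductionAtPrime 2) (hss : Even (W'.LFunction 2))
    (hadd : ¬ W.HasGoodReductionAtPrime 2 ∧ ¬ W.HasMultiplicativeReductionAtPrime 2)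
    (W₀ : WeierstrassCurve ℚ) [W₀.IsElliptic] [W₀.IsGloballyMinimal] {N₀ : ℕ} [NeZero N₀]
    (D₀ : ModularParametrizationData W₀ N₀) (hiso : IsIsogenous W W₀)
    (h₀ : ∀ z ∈ D₀.L.lattice, ∃ w ∈ periodLattice D₀.f, z = D₀.c * w) :
    ¬ (2 : ℤ) ∣ D₀.maninConstant := by
  have hdZ : d ≠ 0 := by rcases hd with rfl | rfl <;> norm_num
  have hd0 : (d : ℚ) ≠ 0 := by exact_mod_cast hdZ
  -- the levels are the conductors
  have hLW₀ : W.LFunction = W₀.LFunction := LFunction_eq_of_isIsogenous_holds W W₀ hiso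
  have hnfW : IsNewformOf W D₀.f :=
    ⟨D₀.isNewformOf.1, fun n ↦ by rw [D₀.isNewformOf.2 n, hLW₀]⟩
  have hN₀ : N₀ = W.conductorNorm ℤ :=
    IsNewformOf.level_eq_conductorNorm_of_exists_isNewformOf hnf hnfW
  haveI : NeZero (W'.conductorNorm ℤ) := ⟨(conductorNorm_pos_holds W').ne'⟩
  -- the optimal `X₀`-datum `D'` of `𝒜'`, on a globally minimal `W₁' ∼ W'`
  obtain ⟨f', hf'⟩ := hnf W'
  obtain ⟨W₁', hE₁', hM₁', D', hD'f, hiso₁, hmin⟩ :=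
    exists_optimal_modularParametrizationData_of_isNewformOf' (W'.conductorNorm ℤ) W' rfl hf'
  haveI := hE₁'
  haveI := hM₁'
  have hopt' : ∀ z ∈ D'.L.lattice, ∃ w ∈ periodLattice D'.f, z = D'.c * w :=
    D'.latticeEq_of_forall_modularDegree_le fun W₂ _ D₂ h2 ↦ hmin W₂ D₂ (h2.trans hD'f)
  have hN'₁ : W'.conductorNorm ℤ = W₁'.conductorNorm ℤ :=
    IsNewformOf.level_eq_conductorNorm_of_exists_isNewformOf hnf D'.isNewformOf
  -- `2 ∤ N(W')` (good at `2`); `W₁'` is good at `2` with `a₂(W₁') = a₂(W')` even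
  have h2N' : ¬ 2 ∣ W'.conductorNorm ℤ :=
    not_two_dvd_conductorNorm_of_hasGoodReductionAtPrime_two W' hgood
  have h4N' : ¬ 2 ^ 2 ∣ W'.conductorNorm ℤ := fun h ↦ h2N' (dvd_trans ⟨2, by norm_num⟩ h)
  have hgood₁ : W₁'.HasGoodReductionAtPrime 2 :=
    hasGoodReductionAtPrime_two_of_not_two_dvd_conductorNorm W₁' (by rw [← hN'₁]; exact h2N')
  have hss₁ : Even (W₁'.LFunction 2) := by
    rwa [LFunction_eq_of_isIsogenous_holds W' W₁' hiso₁] at hss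
  -- K2: the twisted equation `C := W₁' ⊗ χ_d` is globally minimal; its Néron pair is `s⁻¹ Λ'`
  haveI : (W₁'.quadraticTwist (d : ℚ)).IsElliptic := W₁'.isElliptic_quadraticTwist hd0
  haveI : (W₁'.quadraticTwist (d : ℚ)).IsGloballyMinimal :=
    isGloballyMinimal_quadraticTwist_two_of_even_LFunction_two W₁' hd hgood₁ hss₁
  have hG0 : gaussSum χ (ZMod.stdAddChar (N := 8)) ≠ 0 :=
    gaussSum_stdAddChar_ne_zero_of_isPrimitive hχp
  have hs0 : gaussSum χ (ZMod.stdAddChar (N := 8)) / 2 ≠ 0 := div_ne_zero hG0 two_ne_zero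
  have hs2 : (gaussSum χ (ZMod.stdAddChar (N := 8)) / 2) ^ 2 = ((d : ℚ) : ℂ) := by
    rw [div_pow, hG]
    push_cast
    ring
  have hC : IsNeronLatticeOf ((W₁'.quadraticTwist (d : ℚ)).baseChange ℂ)
      (D'.L.mulLeft (gaussSum χ (ZMod.stdAddChar (N := 8)) / 2)⁻¹ (inv_ne_zero hs0)) :=
    isNeronLatticeOf_quadraticTwist_of_sq_eq (d : ℚ) D'.isNeronLattice hs0 hs2
  have hLC : ∀ z : ℂ, gaussSum χ (ZMod.stdAddChar (N := 8)) / 2 * z ∈ D'.L.lattice →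
      ((1 : ℤ) : ℂ) * z ∈
        (D'.L.mulLeft (gaussSum χ (ZMod.stdAddChar (N := 8)) / 2)⁻¹ (inv_ne_zero hs0)).lattice := by
    intro z hz
    rw [PeriodPair.mem_mulLeft_lattice, inv_inv, Int.cast_one, one_mul]
    exact hz
  -- the newform of `𝒜` is the `χ`-twist of that of `𝒜'`
  have hLtw : W.LFunction = (W'.quadraticTwist (d : ℚ)).LFunction := by
    haveI : (W'.quadraticTwist (d : ℚ)).IsElliptic := W'.isElliptic_quadraticTwist hd0
    exact LFunction_eq_of_isIsogenous_holds _ _ htw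
  have hf : ∀ n : ℕ, cuspCoeff D₀.f n = χ n * cuspCoeff D'.f n := by
    intro n
    have hLn : W₀.LFunction n = W.LFunction n := by rw [hLW₀]
    rw [D₀.isNewformOf.2 n, hD'f, hf'.2 n, hLn]
    by_cases h2n : 2 ∣ n
    · have h0 : W.LFunction n = 0 :=
        W.LFunction_apply_eq_zero_of_not_good_of_not_mult 2 hadd.1 hadd.2 h2n
      rw [h0, hχeven n h2n]
      simp
    · have hLn' : W.LFunction n = (W'.quadraticTwist (d : ℚ)).LFunction n := by rw [hLtw]
      rw [hLn', hχodd n h2n]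
  -- conductor bookkeeping at level `N₀ = N(W)`
  have hN : W'.conductorNorm ℤ ∣ N₀ := by rw [hN₀]; exact hN'N
  have hm : 8 ^ 2 ∣ N₀ := by rw [hN₀]; exact hmN
  -- S1 + K1: the Hecke relation at `2` for `f' = D'.f` (odd level) gives the half-Gauss-sum step
  obtain ⟨k, hk⟩ := hss₁
  have hT₂ : ∀ r : ℚ, (2 * k : ℂ) * modularSymbol D'.f r =
      ∑ j : Fin 2, modularSymbol D'.f ((r + j) / 2) + modularSymbol D'.f (2 * r) := by
    intro r
    have h := cuspCoeff_mul_modularSymbol 2 D'.isNewformOf.1 Nat.prime_two h2N' r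
    rw [D'.isNewformOf.2 2, hk] at h
    push_cast at h
    rw [show (k : ℂ) + k = 2 * k by ring] at h
    exact h
  have hstep : ∀ w ∈ periodLattice (charTwist N₀ hN hm hχq D'.f),
      gaussSum χ (ZMod.stdAddChar (N := 8)) / 2 * w ∈ periodLattice D'.f :=
    fun w hw ↦ half_gaussSum_mul_mem_periodLattice_of_heckeTwo N₀ hN hm hχq hχp hε hχsum D'.f
      h2N' k hT₂ hw
  -- G1: the engine with scalar `s = g(χ)/2` and `r = 1`; Česnavičius at the `2`-good level of `𝒜'`
  have hdvd : D₀.c ∣ 1 * D'.c :=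
    maninConstant_dvd_mul_of_twistStep D' D₀ h₀ hχq hχp hN hm hf
      (gaussSum χ (ZMod.stdAddChar (N := 8)) / 2) hstep hC 1 hLC
  rw [one_mul] at hdvd
  have h1 : ¬ (2 : ℤ) ∣ D'.maninConstant :=
    cesnavicius2018_not_dvd_maninConstant_of_not_sq_dvd_level hM hAU hC2 W₁' D' hopt'
      Nat.prime_two h4N'
  exact fun h2 ↦ h1 (h2.trans hdvd)

end Core

/-! ## 3. The leaf E-an-1 and the stub `stub_etaTwo` -/

section Leaf

/-- **E-an-1 `TwoNotDvdManinOfTwistEtaTwo` PROVED** (Stevens' case `η = 2` on `Γ₀`): modulo the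
by-name printed facts `hM hAU hC2 hnf`, for `W ∼ W′ ⊗ χ_d`, `d = ±2`, `W′` globally minimal, GOOD at
`2` with `a₂(W′)` even, `N(W′) ∣ N(W)`, `(4|d|)² ∣ N(W)`, `W` additive at `2`: every lattice-optimal
datum `D₀` of every globally minimal `W₀ ∼ W` has `2 ∤ D₀.maninConstant`. Dispatch on `d`: `χ₈`
(`d = 2`, `g² = 8`, shape `F1 − F3 − F5 + F7`) and `χ₈′` (`d = −2`, `g² = −8`, shape
`F1 + F3 − F5 − F7`), then `not_two_dvd_maninConstant_of_twist_etaTwo_of_char`.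
[cite: Stevens1989, Lemmas (5.2), (5.4), (5.6)–(5.7), pp. 96–98] [cite: Cesnavicius2018, Thm. 1.2]
[cite: Pal2012, Prop. 2.4 and Lemma 3.1] -/
theorem twoNotDvdManinOfTwistEtaTwo_holds : TwoNotDvdManinOfTwistEtaTwo := by
  intro hM hAU hC2 hnf W _ W' _ _ d hd htw hN'N hmN hgood hss hadd W₀ _ _ N₀ _ D₀ hiso h₀
  have hmN' : 8 ^ 2 ∣ W.conductorNorm ℤ := by
    have habs : d.natAbs = 2 := by rcases hd with rfl | rfl <;> rfl
    rw [habs] at hmN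
    simpa using hmN
  rcases hd with rfl | rfl
  · -- `χ₈`
    refine not_two_dvd_maninConstant_of_twist_etaTwo_of_char hM hAU hC2 hnf (Or.inl rfl)
      isQuadratic_χ₈_ringHomComp isPrimitive_χ₈_ringHomComp
      (by rw [gaussSum_χ₈_ringHomComp_sq]; norm_num) (ε := -1) (Or.inr rfl) sum_χ₈_shape
      (fun n hn ↦ ?_) (fun n hn ↦ ?_) htw hN'N hmN' hgood hss hadd W₀ D₀ hiso h₀
    · rw [show ((2 : ℤ) : ℚ) = 2 by norm_num, W'.LFunction_quadraticTwist_two_apply_of_odd hn,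
        Int.cast_mul, χ₈_ringHomComp_apply_natCast]
    · rw [χ₈_ringHomComp_apply_natCast, ZMod.χ₈_nat_eq_if_mod_eight,
        if_pos (Nat.mod_eq_zero_of_dvd hn)]
      simp
  · -- `χ₈′`
    refine not_two_dvd_maninConstant_of_twist_etaTwo_of_char hM hAU hC2 hnf (Or.inr rfl)
      isQuadratic_χ₈'_ringHomComp isPrimitive_χ₈'_ringHomComp
      (by rw [gaussSum_χ₈'_ringHomComp_sq]; norm_num) (ε := 1) (Or.inl rfl) sum_χ₈'_shape
      (fun n hn ↦ ?_) (fun n hn ↦ ?_) htw hN'N hmN' hgood hss hadd W₀ D₀ hiso h₀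
    · rw [show ((-2 : ℤ) : ℚ) = -2 by norm_num, W'.LFunction_quadraticTwist_neg_two_apply_of_odd hn,
        Int.cast_mul, χ₈'_ringHomComp_apply_natCast]
    · rw [χ₈'_ringHomComp_apply_natCast, ZMod.χ₈'_nat_eq_if_mod_eight,
        if_pos (Nat.mod_eq_zero_of_dvd hn)]
      simp

/-- **E-an-2 `TwoNotDvdManinOfTwistOfSemistableAtTwo`** (the `|Φ₂| ≤ 2` law: every class that is a
`χ₋₄ / χ_{±8}`-twist of a class semistable at `2` has odd Manin constant, modulo the printed facts)
follows by the landed edge `twoNotDvdManinOfTwistOfSemistableAtTwo_of_etaTwo` (η = 1 inside).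
[cite: Stevens1989, Lemmas (5.2), (5.4)] [cite: Cesnavicius2018, Thm. 1.2] -/
theorem twoNotDvdManinOfTwistOfSemistableAtTwo_holds : TwoNotDvdManinOfTwistOfSemistableAtTwo :=
  twoNotDvdManinOfTwistOfSemistableAtTwo_of_etaTwo twoNotDvdManinOfTwistEtaTwo_holds

end Leaf

end Summit.BirchSwinnertonDyer.BirchSwinnertonDyer.Theorems

namespace Summit.BirchSwinnertonDyer.BirchSwinnertonDyer.Cruxes.ManinOddAtFour.DyadicTwist

/-- **STUB 1 of line `dyadic-twist` of crux `ManinOddAtFour` (stmt-BirchSwinnertonDyer-22967):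
`stub_etaTwo`** — the registered statement, the leaf E-an-1 BY NAME, proved
(`Theorems.twoNotDvdManinOfTwistEtaTwo_holds`). [cite: Stevens1989, Lemmas (5.2), (5.4), (5.6)–(5.7)] -/
theorem stub_etaTwo : TwoNotDvdManinOfTwistEtaTwo :=
  Summit.BirchSwinnertonDyer.BirchSwinnertonDyer.Theorems.twoNotDvdManinOfTwistEtaTwo_holds

end Summit.BirchSwinnertonDyer.BirchSwinnertonDyer.Cruxes.ManinOddAtFour.DyadicTwist

end
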